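import Summits.NavierStokesRegularity.NavierStokesRegularity.Theorems.FrozenSignCascadeBoundedEnvelopeContinuationMorreyUnitScale
import Literature.Analysis.FluidPDE.LocalTypeIMorreyProofs
import HarnessLib

/-!
# Route FrozenSignCascade · crux `BoundedEnvelopeContinuation` — stub Z5, part 2:
# `𝐈((EuclideanSpace ℝ (Fin 3)) × ℝ₋) < ∞` for a bounded ancient classical solution with the Morrey bound at all radii

Helper file for the crux item stmt-NavierStokesRegularity-10579 (`BoundedEnvelopeContinuation`,
conjunct (B) of route `FrozenSignCascade`); lands `--supports` that item (stub
`stub_liouvilleMorreyOfNoLocalTypeI` of the registered line). Sequel of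
`…MorreyUnitScale.lean`.

For a classical solution `(v, P)` of the unforced unit-viscosity system on `(-∞,0)`, bounded by
`V`, with `∫_{B_r(y)} ‖v t‖² ≤ M r` for all `t < 0`, `y`, `r > 0`:

* `cknC_le_linear`, `cknDOsc_le_of_morrey`, `localEnergy_le` — the unit-scale estimates of part 1
  on EVERY past ball `Q(z, r)`, `z.1 ≤ 0`, by the zoom about `z` (`zoom_setting` and the scale
  covariance `cknC_nsZoom`, `cknDOsc_nsZoom`, `cknAEss_nsZoom`, `cknE_nsZoom`): the a priori
  LINEAR growth `C(r) ≤ rVM`, `D(r) ≤ 9K₁ C(3r) + K₂M^{3/2}`, and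
  `A(r) + E(r) ≤ c₁C(2r)^{2/3} + c₂C(2r) + c₃D(2r)^{2/3}C(2r)^{1/3}`.
* `exists_abScaledSum_le_of_morrey` — the bootstrap: with the multiplicative inequality
  `C ≤ C₀A^{3/4}(A + E)^{3/4}` (`Seregin2020.exists_cknC_le_finer`, sublinear in `E`) and Young's
  inequality, `C(r) ≤ λ C(6r) + K*` with `6λ ≤ 1/2`; iterating towards LARGE scales against the
  linear a priori growth gives `C(r) ≤ 2K* + 2⁻ⁿVMr` for every `n`, i.e. `C ≤ 2K*` on every ball,
  hence `E`, `D` bounded, and `A ≤ M`.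
* `typeIBound_slab_lt_top_of_morrey` — `𝐈((EuclideanSpace ℝ (Fin 3)) × ℝ₋) = typeIBound (Iio 0 ×ˢ univ) v P ∇v < ⊤`.

This is Albritton–Barker 2019, Lemma 2.6 (after Seregin 2006, Lemma 2.1 (c): `sup A < ∞ ⇒ 𝐈 <
∞` locally, with constants depending on the background quantities) in the GLOBAL setting of the
whole past, where the background dependence is removed by the scale-invariant a priori growth.

## References

* D. Albritton, T. Barker, J. Math. Fluid Mech. 21 (2019) = arXiv:1811.00502, Thm 1.1, §3,
  Lemma 2.6 and Rem. 3.2. [AlbrittonBarker2019]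
* G. Seregin, arXiv:math/0607537 = J. Math. Sci. 143 (2007), §2, Lemma 2.1 (estimates between
  the scaled energies). [Seregin2006]
* T. Tao, Anal. PDE 6 (2013), §4, proof of Lemma 4.1 (i) (pressure identification). [Tao2011]
* G. Koch, N. Nadirashvili, G. Seregin, V. Šverák, Acta Math. 203 (2009), §1.
  [KochNadirashviliSereginSverak2009]
-/

noncomputable section

set_option linter.dupNamespace false -- nested layout Summit.<S>.<Sub>, Sub = S (D-0017)
-- nested operator types `(EuclideanSpace ℝ (Fin 3)) →L[ℝ] (EuclideanSpace ℝ (Fin 3)) →L[ℝ] (EuclideanSpace ℝ (Fin 3)) →L[ℝ] ℝ` (pressure kernels)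
set_option maxSynthPendingDepth 3

open Set MeasureTheory Filter Topology Metric Function
open scoped ENNReal NNReal
open Literature.Analysis Literature.Analysis.FluidPDE
open Summit.NavierStokesRegularity.NavierStokesRegularity.Theorems.SingularProfile

namespace Summit.NavierStokesRegularity.NavierStokesRegularity.Theorems.BoundedEnvelope

/-! ### Transfer to every past ball by the Navier–Stokes zoom -/

section Transfer

variable {v : ℝ → (EuclideanSpace ℝ (Fin 3)) → (EuclideanSpace ℝ (Fin 3))} {P : ℝ → (EuclideanSpace ℝ (Fin 3)) → ℝ} {M V : ℝ}

/-- **A priori linear growth of `C`**: `C(Q(z,r)) ≤ r V M` for every past ball of a classical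
solution bounded by `V` with Morrey bound `M` (zoom to the unit scale: the zoom is bounded by
`rV` and has the same Morrey constant). [folklore] -/
theorem cknC_le_linear (hV : 0 ≤ V) (hcl : IsClassicalNSSolutionOn (Iio 0) 1 0 v P)
    (hMor : ∀ t < 0, ∀ (y : (EuclideanSpace ℝ (Fin 3))) (r : ℝ), 0 < r → ∫ x in ball y r, ‖v t x‖ ^ 2 ≤ M * r)
    (hbd : ∀ t < 0, ∀ x, ‖v t x‖ ≤ V) {r : ℝ} (hr : 0 < r) {z : ℝ × (EuclideanSpace ℝ (Fin 3))} (hz : z.1 ≤ 0) :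
    cknC r z v ≤ ENNReal.ofReal (r * V * M) := by
  obtain ⟨hcl', hMor', hbd'⟩ := zoom_setting hcl hMor hbd hr hz z.2
  have h := cknC_one_le_of_bound (mul_nonneg hr.le hV)
    (fun s hs => (hcl'.contDiff_velocity hs).continuous) hMor' hbd'
  rwa [cknC_nsZoom hr one_pos z.1 z.2 0 v, mul_one, stAffine_sq_zero] at h

/-- **`D(Q(z,r)) ≤ K₁ · 9 C(Q(z,3r)) + K₂ M^{3/2}` on every past ball** (the unit-scale estimate
`unit_cknDOsc_le` for the zoom about `z` with factor `r`, and the scale covariance of `C`, `D`).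
[cite: AlbrittonBarker2019, §3, Rem. 3.2] -/
theorem cknDOsc_le_of_morrey {K₁ K₂ : ℝ≥0∞} (hK₁t : K₁ ≠ ⊤)
    (hK : ∀ (u : (EuclideanSpace ℝ (Fin 3)) → (EuclideanSpace ℝ (Fin 3))) (A : ℝ), ContDiff ℝ 4 u →
      (∀ (x : (EuclideanSpace ℝ (Fin 3))) (r : ℝ), 1 ≤ r → ∫ y in ball x r, ‖u y‖ ^ 2 ≤ A * r) →
      ∫⁻ x in ball (0 : (EuclideanSpace ℝ (Fin 3))) 1,
          ‖pressurePotential u x - ⨍ y in ball (0 : (EuclideanSpace ℝ (Fin 3))) 1, pressurePotential u y‖ₑ ^ (3 / 2 : ℝ) ≤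
        K₁ * (∫⁻ y in ball (0 : (EuclideanSpace ℝ (Fin 3))) 3, ‖u y‖ₑ ^ (3 : ℕ)) + K₂ * ENNReal.ofReal A ^ (3 / 2 : ℝ))
    (hM : 0 ≤ M) (hcl : IsClassicalNSSolutionOn (Iio 0) 1 0 v P)
    (hMor : ∀ t < 0, ∀ (y : (EuclideanSpace ℝ (Fin 3))) (r : ℝ), 0 < r → ∫ x in ball y r, ‖v t x‖ ^ 2 ≤ M * r)
    (hbd : ∀ t < 0, ∀ x, ‖v t x‖ ≤ V) {r : ℝ} (hr : 0 < r) {z : ℝ × (EuclideanSpace ℝ (Fin 3))} (hz : z.1 ≤ 0) :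
    cknDOsc r z P ≤
      K₁ * (ENNReal.ofReal 3 ^ 2 * cknC (3 * r) z v) + K₂ * ENNReal.ofReal M ^ (3 / 2 : ℝ) := by
  obtain ⟨hcl', hMor', -⟩ := zoom_setting hcl hMor hbd hr hz z.2
  have h := unit_cknDOsc_le hK₁t hK hM hcl' hMor'
  rw [cknDOsc_nsZoom hr one_pos, mul_one, stAffine_sq_zero,
    cknC_nsZoom hr (by norm_num : (0 : ℝ) < 3), stAffine_sq_zero, mul_comm r 3] at h
  exact h

/-- **The local energy inequality on every past ball**, with the mean-free `D`:
`A(Q(z,r)) + E(Q(z,r)) ≤ c₁ C(2r)^{2/3} + c₂ C(2r) + c₃ D(2r)^{2/3} C(2r)^{1/3}` (the unit-scale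
estimate `unit_localEnergy` for the zoom about `z` with factor `2r`).
[cite: Seregin2006, §2 (2.1)–(2.6)] -/
theorem localEnergy_le {c₁ c₂ c₃ : ℝ≥0}
    (HT : ∀ (Q : TopologicalSpace.Opens (ℝ × (EuclideanSpace ℝ (Fin 3)))) (u : ℝ → (EuclideanSpace ℝ (Fin 3)) → (EuclideanSpace ℝ (Fin 3))) (p : ℝ → (EuclideanSpace ℝ (Fin 3)) → ℝ)
      (G : ℝ → (EuclideanSpace ℝ (Fin 3)) → (EuclideanSpace ℝ (Fin 3)) →L[ℝ] (EuclideanSpace ℝ (Fin 3))), IsSuitableWeakSolutionOn Q 1 0 u p →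
      HasWeakSpatialGradientOn Q u G →
      ∀ (z : ℝ × (EuclideanSpace ℝ (Fin 3))) (R : ℝ), 0 < R → parabolicCylinder R z ⊆ (Q : Set (ℝ × (EuclideanSpace ℝ (Fin 3)))) →
        cknAEss (R / 2) z u + cknE (R / 2) z G ≤
          c₁ * cknC R z u ^ (2 / 3 : ℝ) + c₂ * cknC R z u +
            c₃ * (cknD R z p ^ (2 / 3 : ℝ) * cknC R z u ^ (1 / 3 : ℝ)))
    (hcl : IsClassicalNSSolutionOn (Iio 0) 1 0 v P)
    (hMor : ∀ t < 0, ∀ (y : (EuclideanSpace ℝ (Fin 3))) (r : ℝ), 0 < r → ∫ x in ball y r, ‖v t x‖ ^ 2 ≤ M * r)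
    (hbd : ∀ t < 0, ∀ x, ‖v t x‖ ≤ V) {r : ℝ} (hr : 0 < r) {z : ℝ × (EuclideanSpace ℝ (Fin 3))} (hz : z.1 ≤ 0) :
    cknAEss r z v + cknE r z (fun t x => fderiv ℝ (v t) x) ≤
      c₁ * cknC (2 * r) z v ^ (2 / 3 : ℝ) + c₂ * cknC (2 * r) z v +
        c₃ * (cknDOsc (2 * r) z P ^ (2 / 3 : ℝ) * cknC (2 * r) z v ^ (1 / 3 : ℝ)) := by
  have h2r : 0 < 2 * r := by positivity
  obtain ⟨hcl', -, -⟩ := zoom_setting hcl hMor hbd h2r hz z.2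
  have h := unit_localEnergy HT hcl'
  set c : ℝ := 2 * r with hc
  -- the gradient of the zoom is the zoomed gradient on the unit ball
  have hE : cknE (1 / 2) (0 : ℝ × (EuclideanSpace ℝ (Fin 3))) (fun s y => fderiv ℝ ((c • stPull (c ^ 2) c z.1 z.2 v) s) y) =
      cknE (1 / 2) (0 : ℝ × (EuclideanSpace ℝ (Fin 3))) ((c ^ 2) • stPull (c ^ 2) c z.1 z.2 fun t x => fderiv ℝ (v t) x) := by
    refine cknE_congr_on fun w hw => ?_
    rw [mem_parabolicCylinder] at hw
    have hs : w.1 < 0 := by simpa using hw.1.2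
    have hneg : z.1 + c ^ 2 * w.1 < 0 := by
      nlinarith [mul_pos (pow_pos h2r 2) (neg_pos.2 hs)]
    have hd : Differentiable ℝ (v (z.1 + c ^ 2 * w.1)) :=
      (hcl.contDiff_velocity hneg).differentiable (by simp)
    rw [fderiv_zoom_center z.2 v hd w.2]
    simp [stPull_apply]
  have e : c * (1 / 2) = r := by rw [hc]; ring
  rw [hE, cknAEss_nsZoom h2r (by norm_num : (0 : ℝ) < 1 / 2),
    cknE_nsZoom h2r (by norm_num : (0 : ℝ) < 1 / 2), cknC_nsZoom h2r one_pos,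
    cknDOsc_nsZoom h2r one_pos, mul_one, stAffine_sq_zero, e] at h
  exact h

end Transfer


/-! ### The bootstrap: `𝐈((EuclideanSpace ℝ (Fin 3)) × ℝ₋) < ∞` from the Morrey bound -/

/-- A sublinear power is affinely bounded: `x^p ≤ x + 1` for `0 ≤ p ≤ 1` in `ℝ≥0∞`. [folklore] -/
theorem rpow_le_self_add_one (x : ℝ≥0∞) {p : ℝ} (hp0 : 0 ≤ p) (hp1 : p ≤ 1) : x ^ p ≤ x + 1 := by
  rcases le_total x 1 with h | h
  · calc x ^ p ≤ 1 ^ p := ENNReal.rpow_le_rpow h hp0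
      _ = 1 := ENNReal.one_rpow p
      _ ≤ x + 1 := le_add_self
  · calc x ^ p ≤ x ^ (1 : ℝ) := ENNReal.rpow_le_rpow_of_exponent_le h hp1
      _ = x := ENNReal.rpow_one x
      _ ≤ x + 1 := le_self_add

/-- **Uniform bounds for `A, C, D, E` on every past ball from the Morrey bound** (the bootstrap
of the module docstring). For a classical solution `(v, P)` of the unforced unit-viscosity system
on `(-∞,0)`, bounded by `V`, with `∫_{B_r(y)} ‖v t‖² ≤ M r` for all `t < 0`, `y`, `r > 0`, there
is `K < ∞` with `(A + C + D + E)(Q(z, r)) ≤ K` for every `r > 0` and every centre with `z.1 ≤ 0`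
(`∇v := fderiv`, `D` mean-free). Steps: `D(r) ≤ K₁'C(3r) + K₂'` (`cknDOsc_le_of_morrey`);
`E(r) ≤ a C(6r) + b` (`localEnergy_le`, `C(2r) ≤ 9 C(6r)`, Young); `C(r) ≤ δ(M + E(r)) + K_δ`
(`Seregin2020.exists_cknC_le_finer` + Young), so `C(r) ≤ δa C(6r) + K*` with `δ a ≤ 1/16`; the a
priori linear growth `C(r) ≤ VM r` (`cknC_le_linear`) is then improved inductively to
`C(r) ≤ 2K* + 2⁻ⁿ VM r` for every `n`, i.e. `C ≤ 2K*`.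
[cite: Seregin2006, Lemma 2.1 (c) (arXiv:math/0607537 §2); AlbrittonBarker2019, Lemma 2.6] -/
theorem exists_abScaledSum_le_of_morrey {v : ℝ → (EuclideanSpace ℝ (Fin 3)) → (EuclideanSpace ℝ (Fin 3))} {P : ℝ → (EuclideanSpace ℝ (Fin 3)) → ℝ} {M V : ℝ}
    (hM : 0 ≤ M) (hV : 0 ≤ V) (hcl : IsClassicalNSSolutionOn (Iio 0) 1 0 v P)
    (hMor : ∀ t < 0, ∀ (y : (EuclideanSpace ℝ (Fin 3))) (r : ℝ), 0 < r → ∫ x in ball y r, ‖v t x‖ ^ 2 ≤ M * r)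
    (hbd : ∀ t < 0, ∀ x, ‖v t x‖ ≤ V) :
    ∃ K : ℝ≥0∞, K ≠ ⊤ ∧ ∀ (r : ℝ), 0 < r → ∀ z : ℝ × (EuclideanSpace ℝ (Fin 3)), z.1 ≤ 0 →
      abScaledSum r z v P (fun t x => fderiv ℝ (v t) x) ≤ K := by
  obtain ⟨c₁, c₂, c₃, HT⟩ := Seregin2020.localEnergyBound_top
  obtain ⟨C₀, hC₀⟩ := Seregin2020.exists_cknC_le_finer
  obtain ⟨K₁, K₂, hK₁t, hK₂t, hK⟩ := exists_slice_oscillation_bound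
  set G : ℝ → (EuclideanSpace ℝ (Fin 3)) → (EuclideanSpace ℝ (Fin 3)) →L[ℝ] (EuclideanSpace ℝ (Fin 3)) := fun t x => fderiv ℝ (v t) x with hG
  have hcont : ∀ t < 0, Continuous (v t) := fun t ht => (hcl.contDiff_velocity ht).continuous
  have hQ : (((Literature.Analysis.FluidPDE.slab (EuclideanSpace ℝ (Fin 3)) (Set.Iio (0 : ℝ)) isOpen_Iio) : TopologicalSpace.Opens (ℝ × (EuclideanSpace ℝ (Fin 3)))) : Set (ℝ × (EuclideanSpace ℝ (Fin 3)))) ⊆ Iio (0 : ℝ) ×ˢ univ := by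
    rw [coe_slab]
  have hwg : HasWeakSpatialGradientOn (Literature.Analysis.FluidPDE.slab (EuclideanSpace ℝ (Fin 3)) (Set.Iio (0 : ℝ)) isOpen_Iio) v G :=
    hasWeakSpatialGradientOn_of_contDiffOn isOpen_Iio hQ (hcl.smooth_velocity.of_le (by norm_cast))
  -- ### the constants
  set 𝔐 : ℝ≥0∞ := ENNReal.ofReal M with h𝔐
  set KD₁ : ℝ≥0∞ := K₁ * ENNReal.ofReal 3 ^ 2 with hKD₁
  set KD₂ : ℝ≥0∞ := K₂ * 𝔐 ^ (3 / 2 : ℝ) with hKD₂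
  set a : ℝ≥0∞ := 9 * c₁ + 9 * c₂ + c₃ * (KD₁ + 9) with ha
  set b : ℝ≥0∞ := c₁ + c₃ * KD₂ with hb
  have h𝔐t : 𝔐 ≠ ⊤ := ENNReal.ofReal_ne_top
  have hKD₁t : KD₁ ≠ ⊤ := ENNReal.mul_ne_top hK₁t (ENNReal.pow_ne_top ENNReal.ofReal_ne_top)
  have hKD₂t : KD₂ ≠ ⊤ :=
    ENNReal.mul_ne_top hK₂t (ENNReal.rpow_ne_top_of_nonneg (by norm_num) h𝔐t)
  have h9t : (9 : ℝ≥0∞) ≠ ⊤ := ENNReal.ofNat_ne_top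
  have hat : a ≠ ⊤ := ENNReal.add_ne_top.2 ⟨ENNReal.add_ne_top.2
    ⟨ENNReal.mul_ne_top h9t ENNReal.coe_ne_top, ENNReal.mul_ne_top h9t ENNReal.coe_ne_top⟩,
    ENNReal.mul_ne_top ENNReal.coe_ne_top (ENNReal.add_ne_top.2 ⟨hKD₁t, h9t⟩)⟩
  have hbt : b ≠ ⊤ := ENNReal.add_ne_top.2 ⟨ENNReal.coe_ne_top, ENNReal.mul_ne_top ENNReal.coe_ne_top hKD₂t⟩
  -- the Young parameter `δ` with `δ a ≤ 1/16`
  set θ : ℝ≥0∞ := ENNReal.ofReal 16⁻¹ with hθ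
  set δ : ℝ≥0∞ := θ * (a + 1)⁻¹ with hδ
  have ha1 : a + 1 ≠ 0 := by simp
  have ha1t : a + 1 ≠ ⊤ := ENNReal.add_ne_top.2 ⟨hat, ENNReal.one_ne_top⟩
  have hθ0 : θ ≠ 0 := (ENNReal.ofReal_pos.2 (by norm_num)).ne'
  have hδ0 : δ ≠ 0 := mul_ne_zero hθ0 (ENNReal.inv_ne_zero.2 ha1t)
  have hδt : δ ≠ ⊤ := ENNReal.mul_ne_top ENNReal.ofReal_ne_top (ENNReal.inv_ne_top.2 ha1)
  have hδa : δ * a ≤ θ := by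
    have h1 : (a + 1)⁻¹ * a ≤ 1 := by
      rw [← ENNReal.div_eq_inv_mul]
      exact ENNReal.div_le_of_le_mul (by rw [one_mul]; exact le_self_add)
    calc δ * a = θ * ((a + 1)⁻¹ * a) := by rw [hδ, mul_assoc]
      _ ≤ θ * 1 := by gcongr
      _ = θ := mul_one _
  have hnum1 : 2 * θ ≤ 1 := by
    rw [hθ, ← ENNReal.ofReal_ofNat 2, ← ENNReal.ofReal_mul (by norm_num), ← ENNReal.ofReal_one]
    exact ENNReal.ofReal_le_ofReal (by norm_num)
  have hnum2 : 6 * θ ≤ 2⁻¹ := by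
    rw [hθ, ← ENNReal.ofReal_ofNat 6, ← ENNReal.ofReal_mul (by norm_num), ← ENNReal.ofReal_ofNat 2,
      ← ENNReal.ofReal_inv_of_pos (by norm_num : (0 : ℝ) < 2)]
    exact ENNReal.ofReal_le_ofReal (by norm_num)
  set Kδ : ℝ≥0∞ := ((C₀ : ℝ≥0∞) * 𝔐 ^ (3 / 4 : ℝ) * δ⁻¹ ^ (3 / 4 : ℝ)) ^ (1 / (1 - 3 / 4 : ℝ)) with hKδ
  have hKδt : Kδ ≠ ⊤ := ENNReal.rpow_ne_top_of_nonneg (by norm_num)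
    (ENNReal.mul_ne_top (ENNReal.mul_ne_top ENNReal.coe_ne_top
      (ENNReal.rpow_ne_top_of_nonneg (by norm_num) h𝔐t))
      (ENNReal.rpow_ne_top_of_nonneg (by norm_num) (ENNReal.inv_ne_top.2 hδ0)))
  set Ks : ℝ≥0∞ := δ * (𝔐 + b) + Kδ with hKs
  have hKst : Ks ≠ ⊤ := ENNReal.add_ne_top.2
    ⟨ENNReal.mul_ne_top hδt (ENNReal.add_ne_top.2 ⟨h𝔐t, hbt⟩), hKδt⟩
  -- ### the estimates on a past ball, centre by centre
  have hCfin : ∀ ρ, 0 < ρ → ∀ z : ℝ × (EuclideanSpace ℝ (Fin 3)), z.1 ≤ 0 → cknC ρ z v ≠ ⊤ := fun ρ hρ z hz =>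
    ne_top_of_le_ne_top ENNReal.ofReal_ne_top (cknC_le_linear hV hcl hMor hbd hρ hz)
  -- `D(2r) ≤ KD₁ C(6r) + KD₂`
  have hD : ∀ r, 0 < r → ∀ z : ℝ × (EuclideanSpace ℝ (Fin 3)), z.1 ≤ 0 →
      cknDOsc (2 * r) z P ≤ KD₁ * cknC (6 * r) z v + KD₂ := by
    intro r hr z hz
    have h2r : 0 < 2 * r := by positivity
    have h := cknDOsc_le_of_morrey hK₁t hK hM hcl hMor hbd h2r hz
    rw [show 3 * (2 * r) = 6 * r by ring] at h
    calc cknDOsc (2 * r) z P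
        ≤ K₁ * (ENNReal.ofReal 3 ^ 2 * cknC (6 * r) z v) + K₂ * ENNReal.ofReal M ^ (3 / 2 : ℝ) := h
      _ = KD₁ * cknC (6 * r) z v + KD₂ := by rw [hKD₁, hKD₂, mul_assoc]
  -- `C(2r) ≤ 9 C(6r)`
  have hC26 : ∀ r, 0 < r → ∀ z : ℝ × (EuclideanSpace ℝ (Fin 3)), cknC (2 * r) z v ≤ 9 * cknC (6 * r) z v := by
    intro r hr z
    have h2r : 0 < 2 * r := by positivity
    have h6r : 0 < 6 * r := by positivity
    have h := Seregin2020.cknC_le_mul_of_subset h6r h2r (parabolicCylinder_mono h2r.le (by linarith) z) v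
    have e : ENNReal.ofReal (6 * r / (2 * r)) ^ 2 = 9 := by
      rw [show 6 * r / (2 * r) = 3 by field_simp; norm_num, ← ENNReal.ofReal_pow (by norm_num)]
      norm_num
    rwa [e] at h
  -- `E(r) ≤ a C(6r) + b`
  have hE : ∀ r, 0 < r → ∀ z : ℝ × (EuclideanSpace ℝ (Fin 3)), z.1 ≤ 0 →
      cknE r z G ≤ a * cknC (6 * r) z v + b := by
    intro r hr z hz
    have h := localEnergy_le HT hcl hMor hbd hr hz
    set X := cknC (6 * r) z v with hX
    have hY : (KD₁ * X + KD₂) ^ (2 / 3 : ℝ) * (9 * X) ^ (1 / 3 : ℝ) ≤ (KD₁ * X + KD₂) + 9 * X := by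
      have := Seregin2020.rpow_two_thirds_mul_rpow_one_third_le (KD₁ * X + KD₂) (9 * X)
        one_ne_zero ENNReal.one_ne_top
      simpa using this
    calc cknE r z G ≤ cknAEss r z v + cknE r z G := le_add_self
      _ ≤ c₁ * cknC (2 * r) z v ^ (2 / 3 : ℝ) + c₂ * cknC (2 * r) z v +
            c₃ * (cknDOsc (2 * r) z P ^ (2 / 3 : ℝ) * cknC (2 * r) z v ^ (1 / 3 : ℝ)) := h
      _ ≤ c₁ * (9 * X) ^ (2 / 3 : ℝ) + c₂ * (9 * X) +
            c₃ * ((KD₁ * X + KD₂) ^ (2 / 3 : ℝ) * (9 * X) ^ (1 / 3 : ℝ)) := by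
          gcongr
          · exact hC26 r hr z
          · exact hC26 r hr z
          · exact hD r hr z hz
          · exact hC26 r hr z
      _ ≤ c₁ * (9 * X + 1) + c₂ * (9 * X) + c₃ * ((KD₁ * X + KD₂) + 9 * X) := by
          gcongr
          exact rpow_le_self_add_one _ (by norm_num) (by norm_num)
      _ = a * X + b := by rw [ha, hb]; ring
  -- `A ≤ M`
  have hA : ∀ r, 0 < r → ∀ z : ℝ × (EuclideanSpace ℝ (Fin 3)), z.1 ≤ 0 → cknAEss r z v ≤ 𝔐 := fun r hr z hz =>
    cknAEss_le_of_morrey hcont hMor hr hz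
  -- ### the one-step inequality `C(r) ≤ δ a C(6r) + K*`
  have step : ∀ r, 0 < r → ∀ z : ℝ × (EuclideanSpace ℝ (Fin 3)), z.1 ≤ 0 →
      cknC r z v ≤ δ * a * cknC (6 * r) z v + Ks := by
    intro r hr z hz
    have h6r : 0 < 6 * r := by positivity
    set X := cknC (6 * r) z v with hX
    have hle : parabolicCylinderOpens r z ≤ (Literature.Analysis.FluidPDE.slab (EuclideanSpace ℝ (Fin 3)) (Set.Iio (0 : ℝ)) isOpen_Iio) := by
      intro w hw
      have hw' : w ∈ parabolicCylinder r z := hw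
      show w ∈ (((Literature.Analysis.FluidPDE.slab (EuclideanSpace ℝ (Fin 3)) (Set.Iio (0 : ℝ)) isOpen_Iio) : TopologicalSpace.Opens (ℝ × (EuclideanSpace ℝ (Fin 3)))) : Set (ℝ × (EuclideanSpace ℝ (Fin 3))))
      rw [coe_slab]
      exact parabolicCylinder_subset_past hz hw'
    have hGr : HasWeakSpatialGradientOn (parabolicCylinderOpens r z) v G := hwg.mono hle
    have hEr := hE r hr z hz
    have hEfin : cknE r z G ≠ ⊤ := ne_top_of_le_ne_top
      (ENNReal.add_ne_top.2 ⟨ENNReal.mul_ne_top hat (hCfin _ h6r z hz), hbt⟩) hEr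
    have hAr := hA r hr z hz
    have hAfin : cknAEss r z v ≠ ⊤ := ne_top_of_le_ne_top h𝔐t hAr
    calc cknC r z v
        ≤ C₀ * cknAEss r z v ^ (3 / 4 : ℝ) * (cknAEss r z v + cknE r z G) ^ (3 / 4 : ℝ) :=
          hC₀ v G z r hr hGr hAfin hEfin
      _ ≤ C₀ * 𝔐 ^ (3 / 4 : ℝ) * (𝔐 + (a * X + b)) ^ (3 / 4 : ℝ) := by gcongr
      _ ≤ δ * (𝔐 + (a * X + b)) + Kδ :=
          Seregin2020.rpow_le_mul_add (by norm_num) (by norm_num) _ _ hδ0 hδt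
      _ = δ * a * X + Ks := by rw [hKs]; ring
  -- ### the induction killing the linear growth
  set L : ℝ≥0∞ := ENNReal.ofReal (V * M) with hL
  have hlin : ∀ r, 0 < r → ∀ z : ℝ × (EuclideanSpace ℝ (Fin 3)), z.1 ≤ 0 → cknC r z v ≤ L * ENNReal.ofReal r := by
    intro r hr z hz
    have h := cknC_le_linear hV hcl hMor hbd hr hz
    rwa [show r * V * M = V * M * r by ring, ENNReal.ofReal_mul (mul_nonneg hV hM)] at h
  have hind : ∀ n : ℕ, ∀ r, 0 < r → ∀ z : ℝ × (EuclideanSpace ℝ (Fin 3)), z.1 ≤ 0 →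
      cknC r z v ≤ 2 * Ks + 2⁻¹ ^ n * (L * ENNReal.ofReal r) := by
    intro n
    induction n with
    | zero =>
        intro r hr z hz
        rw [pow_zero, one_mul]
        exact (hlin r hr z hz).trans le_add_self
    | succ n ih =>
        intro r hr z hz
        have h6r : 0 < 6 * r := by positivity
        have e6 : ENNReal.ofReal (6 * r) = 6 * ENNReal.ofReal r := by
          rw [ENNReal.ofReal_mul (by norm_num : (0 : ℝ) ≤ 6), ENNReal.ofReal_ofNat]
        calc cknC r z v ≤ δ * a * cknC (6 * r) z v + Ks := step r hr z hz
          _ ≤ δ * a * (2 * Ks + 2⁻¹ ^ n * (L * ENNReal.ofReal (6 * r))) + Ks := by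
              gcongr
              exact ih _ h6r z hz
          _ ≤ θ * (2 * Ks + 2⁻¹ ^ n * (L * ENNReal.ofReal (6 * r))) + Ks := by gcongr
          _ = (2 * θ) * Ks + Ks + (6 * θ) * (2⁻¹ ^ n * (L * ENNReal.ofReal r)) := by
              rw [e6]; ring
          _ ≤ 1 * Ks + Ks + 2⁻¹ * (2⁻¹ ^ n * (L * ENNReal.ofReal r)) := by gcongr
          _ = 2 * Ks + 2⁻¹ ^ (n + 1) * (L * ENNReal.ofReal r) := by rw [pow_succ]; ring
  have hC : ∀ r, 0 < r → ∀ z : ℝ × (EuclideanSpace ℝ (Fin 3)), z.1 ≤ 0 → cknC r z v ≤ 2 * Ks := by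
    intro r hr z hz
    refine ENNReal.le_of_forall_pos_le_add fun ε hε _ => ?_
    have hB : L * ENNReal.ofReal r ≠ ⊤ := ENNReal.mul_ne_top ENNReal.ofReal_ne_top ENNReal.ofReal_ne_top
    by_cases hB0 : L * ENNReal.ofReal r = 0
    · calc cknC r z v ≤ 2 * Ks + 2⁻¹ ^ 0 * (L * ENNReal.ofReal r) := hind 0 r hr z hz
        _ = 2 * Ks := by rw [hB0, mul_zero, add_zero]
        _ ≤ 2 * Ks + ε := le_self_add
    · have hε0 : ((ε : ℝ≥0∞) / (L * ENNReal.ofReal r)) ≠ 0 :=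
        (ENNReal.div_pos (by exact_mod_cast hε.ne') hB).ne'
      obtain ⟨n, hn⟩ := ENNReal.exists_inv_two_pow_lt hε0
      calc cknC r z v ≤ 2 * Ks + 2⁻¹ ^ n * (L * ENNReal.ofReal r) := hind n r hr z hz
        _ ≤ 2 * Ks + ((ε : ℝ≥0∞) / (L * ENNReal.ofReal r)) * (L * ENNReal.ofReal r) := by
            gcongr
        _ = 2 * Ks + ε := by rw [ENNReal.div_mul_cancel hB0 hB]
  -- ### conclusion
  set KC : ℝ≥0∞ := 2 * Ks with hKC
  have hKCt : KC ≠ ⊤ := ENNReal.mul_ne_top ENNReal.ofNat_ne_top hKst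
  refine ⟨𝔐 + KC + (KD₁ * KC + KD₂) + (a * KC + b), ?_, fun r hr z hz => ?_⟩
  · exact ENNReal.add_ne_top.2 ⟨ENNReal.add_ne_top.2 ⟨ENNReal.add_ne_top.2 ⟨h𝔐t, hKCt⟩,
      ENNReal.add_ne_top.2 ⟨ENNReal.mul_ne_top hKD₁t hKCt, hKD₂t⟩⟩,
      ENNReal.add_ne_top.2 ⟨ENNReal.mul_ne_top hat hKCt, hbt⟩⟩
  have hr2 : 0 < r / 2 := by positivity
  have hr6 : 0 < r / 6 := by positivity
  unfold abScaledSum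
  refine add_le_add (add_le_add (add_le_add (hA r hr z hz) (hC r hr z hz)) ?_) ?_
  · have h := hD (r / 2) hr2 z hz
    rw [show 2 * (r / 2) = r by ring, show 6 * (r / 2) = 3 * r by ring] at h
    exact h.trans (by gcongr; exact hC _ (by positivity) z hz)
  · have h := hE r hr z hz
    exact h.trans (by gcongr; exact hC _ (by positivity) z hz)

/-- **`𝐈((EuclideanSpace ℝ (Fin 3)) × ℝ₋) < ∞` for a bounded classical ancient solution with the Morrey bound at all
radii** (any classical pressure, `∇v := fderiv`): every admissible ball of the slab has top time
`≤ 0`, and `exists_abScaledSum_le_of_morrey` bounds `A + C + D + E` there uniformly.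
[cite: AlbrittonBarker2019, §1 and Lemma 2.6] -/
theorem typeIBound_slab_lt_top_of_morrey {v : ℝ → (EuclideanSpace ℝ (Fin 3)) → (EuclideanSpace ℝ (Fin 3))} {P : ℝ → (EuclideanSpace ℝ (Fin 3)) → ℝ} {M V : ℝ}
    (hM : 0 ≤ M) (hV : 0 ≤ V) (hcl : IsClassicalNSSolutionOn (Iio 0) 1 0 v P)
    (hMor : ∀ t < 0, ∀ (y : (EuclideanSpace ℝ (Fin 3))) (r : ℝ), 0 < r → ∫ x in ball y r, ‖v t x‖ ^ 2 ≤ M * r)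
    (hbd : ∀ t < 0, ∀ x, ‖v t x‖ ≤ V) :
    typeIBound (Iio (0 : ℝ) ×ˢ (univ : Set (EuclideanSpace ℝ (Fin 3)))) v P (fun t x => fderiv ℝ (v t) x) < ⊤ := by
  obtain ⟨K, hKt, hK⟩ := exists_abScaledSum_le_of_morrey hM hV hcl hMor hbd
  refine lt_of_le_of_lt (typeIBound_le_iff.2 fun r hr z hz => hK r hr z ?_) hKt.lt_top
  -- a parabolic ball inside the backward slab has a non-positive top time
  by_contra hz0
  push Not at hz0
  have hε0 : 0 < min (r ^ 2 / 2) (z.1 / 2) := lt_min (by positivity) (by linarith)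
  have hw : (z.1 - min (r ^ 2 / 2) (z.1 / 2), z.2) ∈ parabolicCylinder r z := by
    rw [mem_parabolicCylinder]
    refine ⟨⟨?_, ?_⟩, by simpa using hr⟩
    · have : min (r ^ 2 / 2) (z.1 / 2) ≤ r ^ 2 / 2 := min_le_left _ _
      dsimp only; nlinarith [sq_nonneg r]
    · dsimp only; linarith
  have h1 : z.1 - min (r ^ 2 / 2) (z.1 / 2) < 0 := (hz hw).1
  have h2 : min (r ^ 2 / 2) (z.1 / 2) ≤ z.1 / 2 := min_le_right _ _
  linarith

/-- **Registered sub-goal `stub_morreyTypeIBound` of stub Z5** (= `typeIBound_slab_lt_top_of_morrey`,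
stated without local notation): `𝐈((EuclideanSpace ℝ (Fin 3)) × ℝ₋) < ∞` for a bounded classical ancient solution with
the Morrey bound at all radii. [cite: AlbrittonBarker2019, §1 and Lemma 2.6] -/
theorem stub_morreyTypeIBound :
    ∀ (v : ℝ → EuclideanSpace ℝ (Fin 3) → EuclideanSpace ℝ (Fin 3)) (P : ℝ → EuclideanSpace ℝ
      (Fin 3) → ℝ) (M V : ℝ), 0 ≤ M → 0 ≤ V →
      Literature.Analysis.FluidPDE.IsClassicalNSSolutionOn (Set.Iio 0) 1 0 v P → (∀ t < 0, ∀ (y :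
      EuclideanSpace ℝ (Fin 3)) (r : ℝ), 0 < r → ∫ x in Metric.ball y r, ‖v t x‖ ^ 2 ≤ M * r) →
      (∀ t < 0, ∀ x, ‖v t x‖ ≤ V) → Literature.Analysis.FluidPDE.typeIBound (Set.Iio (0 : ℝ) ×ˢ
      Set.univ) v P (fun t x => fderiv ℝ (v t) x) < ⊤ :=
  fun _ _ _ _ hM hV hcl hMor hbd => typeIBound_slab_lt_top_of_morrey hM hV hcl hMor hbd

end Summit.NavierStokesRegularity.NavierStokesRegularity.Theorems.BoundedEnvelope

end
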